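import Literature.MathematicalPhysics.QuantumFieldTheory.Balaban1983to89.Beta.GradedBubbles

/-!
# `BalabanUV.Beta.D1BFx.GradedBubbleTerms` — road «BF-x» for binder row D1, «A3.c ∕ L-X TAILS» part (A): an3's graded bubble
# `bub f₁ f₂ V W` UNFOLDED to an explicit finite list of ELEMENTARY TERMS `c·(∂^{as₁}f₁)(x − w)·(∂^{as₂}f₂)(w + y)`, the
# vertex differences recorded as SYNTACTIC unit steps on the legs (an identity, not a bound)

HONEST DEPENDENCY (page 1, mandatory): continuum YM on T⁴ ⇐ BetaPertH ∧ nine spine estimates (0/9 proved); BetaPertH ⇐ (D1) ∧ (D4) ∧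
CAP+tail; G-an2-4 gates asym, D1 and NE2/3/4.  HONEST FRAMING (cell contract, verbatim): «discharging `BetaPertH` makes Bałaban's UV
stability UNCONDITIONAL — a real constructive-QFT result; it is NOT the continuum limit and NOT the Clay problem.»  THIS MODULE DISCHARGES
NOTHING of the wall: one DATA structure with a body ([our object] `ETerm` and its `eval`∕`swap`∕`smul`∕`len`) and [folklore] LIST
BOOKKEEPING over an3's `GradedBubbles` (`bub`, `Graded`, `iterD`, `fdiffF`, `shiftF`, the four transfer identities `bub_rowDiff_left∕right`,
`bub_colDiff_left∕right`, `bub_rowSh_*`, `bub_colSh_*`, `bub_append_*`, `bub_smul_*`) — an3's decay theorem `isO_bub` re-run as an IDENTITY that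
keeps the terms instead of bounding them.  No `Prop` is minted, nothing is cited, no hypothesis is a printed statement, 0 sorry.  0 wall binders;
NOT the L-X row, NOT A3.c, NOT (K), NOT D1, NOT `BetaPertH`, NOT continuum, NOT Clay.

ABSOLUTE RULE (cell charter, verbatim): «No internally-minted statement may enter as a cited fact. Every hypothesis is either kernel-proved in
this package or a verbatim quotation of a PUBLISHED theorem with page reference. The manuscript(s) under audit are NOT citable for their own
disputed steps — they are the thing under adjudication; programme-internal (2001/route/tribunal) claims are never citable.»

WHY (owner d1-p2-g9 RULING ρ-g9-31, journal l.29478, «A3.c ∕ L-X TAILS»; this lineage's located note N-d1leaf03g12-1, journal l.29701).  an3's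
`GradedBubbles.isO_bub` bounds a graded bubble through legs with the UNIFORM difference budget `DG 3 2` — three unit differences on ONE leg, each
gaining a power.  The road's frozen profile `gfrz` has no such third (nor single-leg second) difference row: its rows are d0∕d1 (far, printed) and
h0∕h1 (window, unconditional).  The re-cut (β′) therefore has to see the INDIVIDUAL located-pair terms of the three L-X words — to move, by one
summation by parts in the relative position `w`, a difference off a leg whose partner leg carries none (part (C)).  This file supplies exactly that
view: for graded stencils `V`, `W` (gradings `n₁`, `n₂`) a finite list of elementary terms `t = (c, x, y, as₁, as₂)` — coefficient, the two leg
offsets, and the unit steps landing on each leg — with `n₁ + n₂ ≤ |as₁| + |as₂|` for every term and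
`bub f₁ f₂ V W L k w = Σ_{t} c·(iterD as₁ f₁) L k (x − w)·(iterD as₂ f₂) L k (w + y)` for ALL leg families `f₁, f₂`.
* §1 [folklore] `fdiffF_comm`, `fdiffF_iterD` (`fdiffF a (iterD as h) = iterD (a :: as) h`), `iterD_append`, `shiftF_shiftF`, `shiftF_zero`, `iterD_isO`, `iterD_add`∕`iterD_sub`, `iterD_const_apply`.
* §2 [our object] `ETerm`, `ETerm.eval`, `ETerm.swap`, `ETerm.smul`, `ETerm.len`; [folklore] `eval_smul`, `eval_neg_eq_eval_swap`, list lemmas.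
* §3 [folklore] `baseTerms` + `bub_eq_sum_baseTerms` (raw stencils), `exists_eterms_right` (second vertex graded), **`exists_eterms_of_graded`**.
Unit `b2b-balaban-beta-d1-formalise-leaf-03` (gen 12), D1 formalisation swarm; `LEAVES-BFx.md` row «A3.c ∕ L-X TAILS» part (A).
-/

noncomputable section

namespace Summit.QuantumFields.BalabanUV.Beta.D1BFx.GradedBubbleTerms

open Literature.MathematicalPhysics.QuantumFieldTheory.Balaban1983to89.Beta
open DyadicShell (Pt)
open GradedBubbles (Fam IsO LP Stn term bubRow bub rowSh colSh smulS rowDiff colDiff Graded shiftF fdiffF iterD IsStep bub_append_left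
  bub_append_right bub_smul_left bub_smul_right bub_rowSh_left bub_rowSh_right bub_colSh_left bub_colSh_right bub_rowDiff_left bub_rowDiff_right
  bub_colDiff_left bub_colDiff_right fdiffF_shiftF iterD_shiftF)

/-! ## §1 Difference∕translation calculus on families -/

/-- [folklore] Unit-step (indeed any) forward differences commute. -/
theorem fdiffF_comm (a b : Pt) (h : Fam) : fdiffF a (fdiffF b h) = fdiffF b (fdiffF a h) := by
  funext L k w
  simp only [fdiffF]
  rw [add_right_comm w a b]
  ring

/-- [folklore] A forward difference of an iterated difference is the iterated difference with the step PREPENDED: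
`fdiffF a (iterD as h) = iterD (a :: as) h`. -/
theorem fdiffF_iterD (a : Pt) (as : List Pt) (h : Fam) : fdiffF a (iterD as h) = iterD (a :: as) h := by
  induction as generalizing h with
  | nil => rfl
  | cons b as ih =>
      show fdiffF a (iterD as (fdiffF b h)) = iterD as (fdiffF b (fdiffF a h))
      rw [ih, fdiffF_comm]
      rfl

/-- [folklore] Iterated differences along a concatenated step list. -/
theorem iterD_append (as bs : List Pt) (h : Fam) : iterD (as ++ bs) h = iterD bs (iterD as h) := by
  induction as generalizing h with
  | nil => rfl
  | cons a as ih => exact ih (fdiffF a h)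

/-- [folklore] Two translations compose to one. -/
theorem shiftF_shiftF (a b : Pt) (h : Fam) : shiftF a (shiftF b h) = shiftF (a + b) h := by
  funext L k w
  simp only [shiftF]
  rw [add_assoc]

/-- [folklore] `shiftF 0` is the identity. -/
theorem shiftF_zero (h : Fam) : shiftF 0 h = h := by
  funext L k w
  simp only [shiftF, add_zero]

/-- [folklore] Iterated differences do not increase the decay degree needed crudely: `IsO p h → IsO p (iterD as h)`. -/
theorem iterD_isO {p : ℕ} {h : Fam} (as : List Pt) (hh : IsO p h) : IsO p (iterD as h) := by
  induction as generalizing h with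
  | nil => exact hh
  | cons a as ih => exact ih (hh.fdiffF a)

/-- [folklore] Iterated differences are additive in the family. -/
theorem iterD_add (as : List Pt) (f g : Fam) : iterD as (f + g) = iterD as f + iterD as g := by
  induction as generalizing f g with
  | nil => rfl
  | cons a as ih =>
      show iterD as (fdiffF a (f + g)) = iterD as (fdiffF a f) + iterD as (fdiffF a g)
      rw [GradedBubbles.fdiffF_add, ih]

/-- [folklore] Iterated differences are subtractive in the family. -/
theorem iterD_sub (as : List Pt) (f g : Fam) : iterD as (f - g) = iterD as f - iterD as g := by
  have h := iterD_add as (f - g) g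
  rw [sub_add_cancel] at h
  rw [h, add_sub_cancel_right]

/-- [folklore] Iterated differences of a constant family are a constant family (the dummy indices are not seen). -/
theorem iterD_const_apply (as : List Pt) (g : Pt → ℝ) (L k : ℕ) (w : Pt) :
    iterD as (fun _ _ => g) L k w = iterD as (fun _ _ => g) 0 0 w := by
  induction as generalizing g with
  | nil => rfl
  | cons a as ih =>
      show iterD as (fdiffF a fun _ _ => g) L k w = iterD as (fdiffF a fun _ _ => g) 0 0 w
      have e : (fdiffF a fun _ _ => g : Fam) = fun _ _ v => g (v + a) - g v := by
        funext L' k' v; rfl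
      rw [e]
      exact ih (fun v => g (v + a) - g v)

/-! ## §2 Elementary terms -/

/-- [our object] **AN ELEMENTARY BUBBLE TERM**: coefficient `c`, first-leg offset `x`, second-leg offset `y`, and the unit steps `as₁`, `as₂`
landing on the first ∕ second leg.  It denotes the family `w ↦ c·(iterD as₁ f₁)(x − w)·(iterD as₂ f₂)(w + y)`.  DATA; asserts nothing. -/
structure ETerm where
  /-- coefficient (a trace of internal matrices times scalars) -/
  c : ℝ
  /-- first-leg offset -/
  x : Pt
  /-- second-leg offset -/
  y : Pt
  /-- steps on the first leg -/
  as₁ : List Pt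
  /-- steps on the second leg -/
  as₂ : List Pt

namespace ETerm

/-- [our object] The family an elementary term denotes through the legs `f₁, f₂`. -/
def eval (f₁ f₂ : Fam) (t : ETerm) : Fam := fun L k w => t.c * (iterD t.as₁ f₁ L k (t.x - w) * iterD t.as₂ f₂ L k (w + t.y))

/-- [our object] The swapped term (legs, offsets and step lists exchanged). -/
def swap (t : ETerm) : ETerm := ⟨t.c, t.y, t.x, t.as₂, t.as₁⟩

/-- [our object] Scalar multiple. -/
def smul (a : ℝ) (t : ETerm) : ETerm := ⟨a * t.c, t.x, t.y, t.as₁, t.as₂⟩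

/-- [our object] Total number of steps. -/
def len (t : ETerm) : ℕ := t.as₁.length + t.as₂.length

/-- [folklore] Unfolding `eval`. -/
theorem eval_apply (f₁ f₂ : Fam) (t : ETerm) (L k : ℕ) (w : Pt) :
    t.eval f₁ f₂ L k w = t.c * (iterD t.as₁ f₁ L k (t.x - w) * iterD t.as₂ f₂ L k (w + t.y)) := rfl

/-- [folklore] `eval` of a scalar multiple. -/
theorem eval_smul (a : ℝ) (f₁ f₂ : Fam) (t : ETerm) (L k : ℕ) (w : Pt) : (t.smul a).eval f₁ f₂ L k w = a * t.eval f₁ f₂ L k w := by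
  simp only [eval, smul]; ring

/-- [folklore] **REFLECTION `w ↦ −w` IS THE LEG SWAP**: `t.eval f₁ f₂ L k (−w) = t.swap.eval f₂ f₁ L k w`. -/
theorem eval_neg_eq_eval_swap (f₁ f₂ : Fam) (t : ETerm) (L k : ℕ) (w : Pt) : t.eval f₁ f₂ L k (-w) = t.swap.eval f₂ f₁ L k w := by
  simp only [eval, swap, sub_neg_eq_add]
  rw [add_comm t.x w, show -w + t.y = t.y - w by abel]
  ring

/-- [folklore] `swap` keeps the steps. -/
theorem steps_swap {t : ETerm} (h : ∀ a ∈ t.as₁ ++ t.as₂, IsStep a) : ∀ a ∈ t.swap.as₁ ++ t.swap.as₂, IsStep a := by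
  intro a ha
  simp only [swap, List.mem_append] at ha
  exact h a (by simp only [List.mem_append]; tauto)

/-- [folklore] `swap` keeps the length. -/
theorem len_swap (t : ETerm) : t.swap.len = t.len := by
  simp only [len, swap]; omega

/-- [folklore] `smul` keeps the steps. -/
theorem steps_smul {t : ETerm} (a : ℝ) (h : ∀ b ∈ t.as₁ ++ t.as₂, IsStep b) : ∀ b ∈ (t.smul a).as₁ ++ (t.smul a).as₂, IsStep b := h

/-- [folklore] `smul` keeps the length. -/
theorem len_smul (t : ETerm) (a : ℝ) : (t.smul a).len = t.len := rfl

end ETerm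

/-- [folklore] Sum of `eval`s over a mapped list of scalar multiples. -/
theorem sum_map_eval_smul (a : ℝ) (f₁ f₂ : Fam) (Lst : List ETerm) (L k : ℕ) (w : Pt) :
    ((Lst.map (ETerm.smul a)).map fun t => t.eval f₁ f₂ L k w).sum = a * (Lst.map fun t => t.eval f₁ f₂ L k w).sum := by
  rw [List.map_map, ← List.sum_map_mul_left]
  congr 1
  refine List.map_congr_left fun t _ => ?_
  exact ETerm.eval_smul a f₁ f₂ t L k w

/-! ## §3 The unfolding of a graded bubble into elementary terms -/

section Stencil

variable {I : Type*} [Fintype I]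

/-- [our object] The elementary terms of a bubble of two RAW stencils through the legs `shiftF c₁ (iterD as₁ ·)`, `shiftF c₂ (iterD as₂ ·)`:
one term per pair `(p, q)`, coefficient `tr(m_p m_q)`, offsets `p.x − q.y + c₁`, `q.x − p.y + c₂`. -/
def baseTerms (c₁ c₂ : Pt) (as₁ as₂ : List Pt) (V W : Stn I) : List ETerm :=
  V.flatMap fun p => W.map fun q => ⟨(p.m * q.m).trace, p.x - q.y + c₁, q.x - p.y + c₂, as₁, as₂⟩

/-- [folklore] One located pair against a raw stencil, unfolded. -/
theorem bubRow_eq_sum_baseTerms (c₁ c₂ : Pt) (as₁ as₂ : List Pt) (p : LP I) (W : Stn I) (f₁ f₂ : Fam) (L k : ℕ) (w : Pt) :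
    bubRow (shiftF c₁ (iterD as₁ f₁)) (shiftF c₂ (iterD as₂ f₂)) p W L k w =
      ((W.map fun q => (⟨(p.m * q.m).trace, p.x - q.y + c₁, q.x - p.y + c₂, as₁, as₂⟩ : ETerm)).map fun t => t.eval f₁ f₂ L k w).sum := by
  induction W with
  | nil => rfl
  | cons q W ih =>
      rw [List.map_cons, List.map_cons, List.sum_cons, ← ih]
      simp only [bubRow, Pi.add_apply]
      congr 1
      simp only [term, shiftF, ETerm.eval]
      rw [show p.x - q.y - w + c₁ = p.x - q.y + c₁ - w by abel, show w + (q.x - p.y) + c₂ = w + (q.x - p.y + c₂) by abel]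

/-- [folklore] **A BUBBLE OF TWO RAW STENCILS, UNFOLDED**: `bub (shiftF c₁ (iterD as₁ f₁)) (shiftF c₂ (iterD as₂ f₂)) V W L k w = Σ_{t ∈ baseTerms} t.eval f₁ f₂ L k w`. -/
theorem bub_eq_sum_baseTerms (c₁ c₂ : Pt) (as₁ as₂ : List Pt) (V W : Stn I) (f₁ f₂ : Fam) (L k : ℕ) (w : Pt) :
    bub (shiftF c₁ (iterD as₁ f₁)) (shiftF c₂ (iterD as₂ f₂)) V W L k w = ((baseTerms c₁ c₂ as₁ as₂ V W).map fun t => t.eval f₁ f₂ L k w).sum := by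
  induction V with
  | nil => rfl
  | cons p V ih =>
      simp only [baseTerms, List.flatMap_cons, List.map_append, List.sum_append] at ih ⊢
      rw [← ih, ← bubRow_eq_sum_baseTerms]
      rfl

/-- [folklore] The base terms carry exactly the given steps and lengths. -/
theorem mem_baseTerms {c₁ c₂ : Pt} {as₁ as₂ : List Pt} {V W : Stn I} {t : ETerm} (ht : t ∈ baseTerms c₁ c₂ as₁ as₂ V W) :
    t.as₁ = as₁ ∧ t.as₂ = as₂ := by
  simp only [baseTerms, List.mem_flatMap, List.mem_map] at ht
  obtain ⟨p, -, q, -, rfl⟩ := ht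
  exact ⟨rfl, rfl⟩

/-- [folklore] **THE UNFOLDING WITH THE SECOND VERTEX GRADED** (inner induction): for a raw first stencil `V` and `Graded n₂ W`, through legs with
pending translations `c₁, c₂` and pending unit-step lists `as₁, as₂`, there is a list of elementary terms, each with unit steps and
`n₂ + |as₁| + |as₂| ≤ len`, unfolding the bubble for ALL leg families. -/
theorem exists_eterms_right (V : Stn I) {n₂ : ℕ} {W : Stn I} (hW : Graded n₂ W) :
    ∀ (c₁ c₂ : Pt) (as₁ as₂ : List Pt), (∀ a ∈ as₁, IsStep a) → (∀ a ∈ as₂, IsStep a) →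
      ∃ Lst : List ETerm, (∀ t ∈ Lst, (∀ a ∈ t.as₁ ++ t.as₂, IsStep a) ∧ n₂ + as₁.length + as₂.length ≤ t.len) ∧
        ∀ (f₁ f₂ : Fam) (L k : ℕ) (w : Pt),
          bub (shiftF c₁ (iterD as₁ f₁)) (shiftF c₂ (iterD as₂ f₂)) V W L k w = (Lst.map fun t => t.eval f₁ f₂ L k w).sum := by
  induction hW with
  | zero W =>
      intro c₁ c₂ as₁ as₂ h₁ h₂
      refine ⟨baseTerms c₁ c₂ as₁ as₂ V W, fun t ht => ?_, fun f₁ f₂ L k w => bub_eq_sum_baseTerms c₁ c₂ as₁ as₂ V W f₁ f₂ L k w⟩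
      obtain ⟨e₁, e₂⟩ := mem_baseTerms ht
      refine ⟨fun a ha => ?_, by simp only [ETerm.len, e₁, e₂]; omega⟩
      rw [e₁, e₂, List.mem_append] at ha
      exact ha.elim (h₁ a) (h₂ a)
  | weaken _ ih =>
      intro c₁ c₂ as₁ as₂ h₁ h₂
      obtain ⟨Lst, hL, hid⟩ := ih c₁ c₂ as₁ as₂ h₁ h₂
      exact ⟨Lst, fun t ht => ⟨(hL t ht).1, by have := (hL t ht).2; omega⟩, hid⟩
  | @rowDiff n W a ha _ ih =>
      intro c₁ c₂ as₁ as₂ h₁ h₂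
      obtain ⟨Lst, hL, hid⟩ := ih c₁ c₂ as₁ (a :: as₂) h₁ (fun b hb => by
        rcases List.mem_cons.mp hb with rfl | hb
        · exact ha
        · exact h₂ b hb)
      refine ⟨Lst, fun t ht => ⟨(hL t ht).1, by have := (hL t ht).2; simp only [List.length_cons] at this; omega⟩, fun f₁ f₂ L k w => ?_⟩
      rw [bub_rowDiff_right, fdiffF_shiftF, fdiffF_iterD]
      exact hid f₁ f₂ L k w
  | @colDiff n W a ha _ ih =>
      intro c₁ c₂ as₁ as₂ h₁ h₂
      obtain ⟨Lst, hL, hid⟩ := ih c₁ c₂ (-a :: as₁) as₂ (fun b hb => by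
        rcases List.mem_cons.mp hb with rfl | hb
        · exact ha.neg
        · exact h₁ b hb) h₂
      refine ⟨Lst, fun t ht => ⟨(hL t ht).1, by have := (hL t ht).2; simp only [List.length_cons] at this; omega⟩, fun f₁ f₂ L k w => ?_⟩
      rw [bub_colDiff_right, fdiffF_shiftF, fdiffF_iterD]
      exact hid f₁ f₂ L k w
  | @rowSh n W a _ ih =>
      intro c₁ c₂ as₁ as₂ h₁ h₂
      obtain ⟨Lst, hL, hid⟩ := ih c₁ (a + c₂) as₁ as₂ h₁ h₂
      refine ⟨Lst, hL, fun f₁ f₂ L k w => ?_⟩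
      rw [bub_rowSh_right, shiftF_shiftF]
      exact hid f₁ f₂ L k w
  | @colSh n W a _ ih =>
      intro c₁ c₂ as₁ as₂ h₁ h₂
      obtain ⟨Lst, hL, hid⟩ := ih (-a + c₁) c₂ as₁ as₂ h₁ h₂
      refine ⟨Lst, hL, fun f₁ f₂ L k w => ?_⟩
      rw [bub_colSh_right, shiftF_shiftF]
      exact hid f₁ f₂ L k w
  | @append n W W' _ _ ih ih' =>
      intro c₁ c₂ as₁ as₂ h₁ h₂
      obtain ⟨Lst, hL, hid⟩ := ih c₁ c₂ as₁ as₂ h₁ h₂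
      obtain ⟨Lst', hL', hid'⟩ := ih' c₁ c₂ as₁ as₂ h₁ h₂
      refine ⟨Lst ++ Lst', fun t ht => ?_, fun f₁ f₂ L k w => ?_⟩
      · rcases List.mem_append.mp ht with ht | ht
        · exact hL t ht
        · exact hL' t ht
      · rw [bub_append_right, Pi.add_apply, Pi.add_apply, Pi.add_apply, hid, hid', List.map_append, List.sum_append]
  | @smul n W a _ ih =>
      intro c₁ c₂ as₁ as₂ h₁ h₂
      obtain ⟨Lst, hL, hid⟩ := ih c₁ c₂ as₁ as₂ h₁ h₂
      refine ⟨Lst.map (ETerm.smul a), fun t ht => ?_, fun f₁ f₂ L k w => ?_⟩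
      · obtain ⟨t', ht', rfl⟩ := List.mem_map.mp ht
        exact ⟨ETerm.steps_smul a (hL t' ht').1, by rw [ETerm.len_smul]; exact (hL t' ht').2⟩
      · rw [bub_smul_right, Pi.smul_apply, Pi.smul_apply, Pi.smul_apply, smul_eq_mul, hid, sum_map_eval_smul]

/-- [folklore] **THE UNFOLDING WITH BOTH VERTICES GRADED** (outer induction; pending leg operations as in `exists_eterms_right`). -/
theorem exists_eterms_aux {n₁ : ℕ} {V : Stn I} (hV : Graded n₁ V) :
    ∀ {n₂ : ℕ} {W : Stn I}, Graded n₂ W → ∀ (c₁ c₂ : Pt) (as₁ as₂ : List Pt), (∀ a ∈ as₁, IsStep a) → (∀ a ∈ as₂, IsStep a) →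
      ∃ Lst : List ETerm, (∀ t ∈ Lst, (∀ a ∈ t.as₁ ++ t.as₂, IsStep a) ∧ n₁ + n₂ + as₁.length + as₂.length ≤ t.len) ∧
        ∀ (f₁ f₂ : Fam) (L k : ℕ) (w : Pt),
          bub (shiftF c₁ (iterD as₁ f₁)) (shiftF c₂ (iterD as₂ f₂)) V W L k w = (Lst.map fun t => t.eval f₁ f₂ L k w).sum := by
  induction hV with
  | zero V =>
      intro n₂ W hW c₁ c₂ as₁ as₂ h₁ h₂
      obtain ⟨Lst, hL, hid⟩ := exists_eterms_right V hW c₁ c₂ as₁ as₂ h₁ h₂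
      exact ⟨Lst, fun t ht => ⟨(hL t ht).1, by have := (hL t ht).2; omega⟩, hid⟩
  | weaken _ ih =>
      intro n₂ W hW c₁ c₂ as₁ as₂ h₁ h₂
      obtain ⟨Lst, hL, hid⟩ := ih hW c₁ c₂ as₁ as₂ h₁ h₂
      exact ⟨Lst, fun t ht => ⟨(hL t ht).1, by have := (hL t ht).2; omega⟩, hid⟩
  | @rowDiff n V a ha _ ih =>
      intro n₂ W hW c₁ c₂ as₁ as₂ h₁ h₂
      obtain ⟨Lst, hL, hid⟩ := ih hW c₁ c₂ (a :: as₁) as₂ (fun b hb => by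
        rcases List.mem_cons.mp hb with rfl | hb
        · exact ha
        · exact h₁ b hb) h₂
      refine ⟨Lst, fun t ht => ⟨(hL t ht).1, by have := (hL t ht).2; simp only [List.length_cons] at this; omega⟩, fun f₁ f₂ L k w => ?_⟩
      rw [bub_rowDiff_left, fdiffF_shiftF, fdiffF_iterD]
      exact hid f₁ f₂ L k w
  | @colDiff n V a ha _ ih =>
      intro n₂ W hW c₁ c₂ as₁ as₂ h₁ h₂
      obtain ⟨Lst, hL, hid⟩ := ih hW c₁ c₂ as₁ (-a :: as₂) h₁ (fun b hb => by
        rcases List.mem_cons.mp hb with rfl | hb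
        · exact ha.neg
        · exact h₂ b hb)
      refine ⟨Lst, fun t ht => ⟨(hL t ht).1, by have := (hL t ht).2; simp only [List.length_cons] at this; omega⟩, fun f₁ f₂ L k w => ?_⟩
      rw [bub_colDiff_left, fdiffF_shiftF, fdiffF_iterD]
      exact hid f₁ f₂ L k w
  | @rowSh n V a _ ih =>
      intro n₂ W hW c₁ c₂ as₁ as₂ h₁ h₂
      obtain ⟨Lst, hL, hid⟩ := ih hW (a + c₁) c₂ as₁ as₂ h₁ h₂
      refine ⟨Lst, hL, fun f₁ f₂ L k w => ?_⟩
      rw [bub_rowSh_left, shiftF_shiftF]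
      exact hid f₁ f₂ L k w
  | @colSh n V a _ ih =>
      intro n₂ W hW c₁ c₂ as₁ as₂ h₁ h₂
      obtain ⟨Lst, hL, hid⟩ := ih hW c₁ (-a + c₂) as₁ as₂ h₁ h₂
      refine ⟨Lst, hL, fun f₁ f₂ L k w => ?_⟩
      rw [bub_colSh_left, shiftF_shiftF]
      exact hid f₁ f₂ L k w
  | @append n V V' _ _ ih ih' =>
      intro n₂ W hW c₁ c₂ as₁ as₂ h₁ h₂
      obtain ⟨Lst, hL, hid⟩ := ih hW c₁ c₂ as₁ as₂ h₁ h₂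
      obtain ⟨Lst', hL', hid'⟩ := ih' hW c₁ c₂ as₁ as₂ h₁ h₂
      refine ⟨Lst ++ Lst', fun t ht => ?_, fun f₁ f₂ L k w => ?_⟩
      · rcases List.mem_append.mp ht with ht | ht
        · exact hL t ht
        · exact hL' t ht
      · rw [bub_append_left, Pi.add_apply, Pi.add_apply, Pi.add_apply, hid, hid', List.map_append, List.sum_append]
  | @smul n V a _ ih =>
      intro n₂ W hW c₁ c₂ as₁ as₂ h₁ h₂
      obtain ⟨Lst, hL, hid⟩ := ih hW c₁ c₂ as₁ as₂ h₁ h₂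
      refine ⟨Lst.map (ETerm.smul a), fun t ht => ?_, fun f₁ f₂ L k w => ?_⟩
      · obtain ⟨t', ht', rfl⟩ := List.mem_map.mp ht
        exact ⟨ETerm.steps_smul a (hL t' ht').1, by rw [ETerm.len_smul]; exact (hL t' ht').2⟩
      · rw [bub_smul_left, Pi.smul_apply, Pi.smul_apply, Pi.smul_apply, smul_eq_mul, hid, sum_map_eval_smul]

/-- [folklore] **THE UNFOLDING OF A GRADED BUBBLE INTO ELEMENTARY TERMS.**  For `Graded n₁ V`, `Graded n₂ W` there is a finite list of elementary
terms — depending on `V`, `W` only — each carrying unit steps of total number `≥ n₁ + n₂`, with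
`bub f₁ f₂ V W L k w = Σ_t t.c·(iterD t.as₁ f₁) L k (t.x − w)·(iterD t.as₂ f₂) L k (w + t.y)` for ALL leg families `f₁, f₂` and all `(L, k, w)`. -/
theorem exists_eterms_of_graded {n₁ : ℕ} {V : Stn I} (hV : Graded n₁ V) {n₂ : ℕ} {W : Stn I} (hW : Graded n₂ W) :
    ∃ Lst : List ETerm, (∀ t ∈ Lst, (∀ a ∈ t.as₁ ++ t.as₂, IsStep a) ∧ n₁ + n₂ ≤ t.len) ∧
      ∀ (f₁ f₂ : Fam) (L k : ℕ) (w : Pt), bub f₁ f₂ V W L k w = (Lst.map fun t => t.eval f₁ f₂ L k w).sum := by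
  obtain ⟨Lst, hL, hid⟩ := exists_eterms_aux hV hW 0 0 [] [] (by simp) (by simp)
  refine ⟨Lst, fun t ht => ⟨(hL t ht).1, by simpa using (hL t ht).2⟩, fun f₁ f₂ L k w => ?_⟩
  have h := hid f₁ f₂ L k w
  simp only [iterD, shiftF_zero] at h
  exact h

end Stencil

end Summit.QuantumFields.BalabanUV.Beta.D1BFx.GradedBubbleTerms

end
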